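import Summits.AnomalousDissipation.AnomalousDissipation.Theorems.MomentParityQuarticGateCoords
import Summits.AnomalousDissipation.AnomalousDissipation.Theorems.MomentParityQuarticGatePolyCalc

/-!
# Row polynomials (infrastructure I4 for `MomentParity.QuarticGate`, line `recession-cone`,
stmt-AnomalousDissipation-11464)

For a cylindrical polynomial test `p(u) = P((u,g₁),…,(u,gₘ))` with level-`N` band test fields `gᵢ`
and an orthonormal band basis `b` of `V_N` (bundle `hb`, `hbo`, `hbs`), the ROW of `p`,
`u ↦ ⟨F(u), ∇p(u)⟩ = Torus.nsGeneratorPairing ν f u (Σᵢ ∂ᵢP(…) gᵢ)`, is, on level-`N` fields, a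
POLYNOMIAL in the coordinates `xᵢ = (u, bᵢ)` of total degree `≤ deg P + 1`, whose top homogeneous
component is the Euler pairing `⟨B(u,u), ∇p_d(u)⟩` of the top component `p_d` of `p`
(`exists_rowPoly`). Ingredients:

* `nsGeneratorPairing_eq_of_level` — for a smooth field `w` and level-`N` `u = Σ xⱼ bⱼ`:
  `⟨F(u), w⟩ = (f,w) + ν Σⱼ xⱼ (bⱼ, Δw) + Σⱼₖ xⱼ xₖ ∫⟪Dw·bⱼ, bₖ⟫` (constant + linear + quadratic);
* `row_eq_eval` — the row of `P` is the evaluation of the explicit polynomial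
  `Σᵢ (∂ᵢP)(ℓ) · Rᵢ`, `ℓⱼ = Σₗ (gⱼ, bₗ) Xₗ` the coordinate forms of the pairings `(u, gⱼ)`
  (`pairing_band_eq_sum`) and `Rᵢ` the quadratic polynomial of `⟨F(u), gᵢ⟩`;
* degree and top-component bookkeeping from `MomentParityQuarticGatePolyCalc`.
-/

namespace Summit.AnomalousDissipation.AnomalousDissipation.Theorems.MomentParityQuarticGate

open MeasureTheory Filter MvPolynomial
open scoped InnerProductSpace RealInnerProductSpace ENNReal
open Literature.Analysis.FunctionSpaces Literature.Analysis.FluidPDE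
open Summit.AnomalousDissipation.AnomalousDissipation.Theses.MomentParity

set_option linter.dupNamespace false

variable {N n : ℕ} {b : Fin n → UnitAddTorus (Fin 3) → EuclideanSpace ℝ (Fin 3)}

/-! ## The generator against a fixed smooth field, in coordinates -/

/-- For smooth `w` and continuous `e`, `y ↦ Dw(y) e(y)` is continuous. [folklore] -/
theorem continuous_fderiv_apply {w e : UnitAddTorus (Fin 3) → EuclideanSpace ℝ (Fin 3)}
    (hw : Torus.IsSmooth w) (he : Continuous e) :
    Continuous fun y => Torus.fderiv w y (e y) := by
  have h1 : (fun y => Torus.fderiv w y (e y)) =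
      fun y => ∑ i, (e y) i • Torus.partialDeriv i w y := funext fun y =>
    Torus.fderiv_apply_eq_sum_partialDeriv (hw.isContDiff (by simp)) _ _
  rw [h1]
  exact continuous_finsetSum _ fun i _ =>
    ((EuclideanSpace.proj i).continuous.comp he).smul (hw.partialDeriv i).continuous

/-- **The generator in coordinates.** For a level-`N` field `u` with coordinates `xⱼ = (u, bⱼ)` and
a smooth field `w`: `⟨F(u), w⟩ = (f, w) + ν Σⱼ xⱼ (bⱼ, Δw) + Σⱼ Σₖ xⱼ xₖ ∫ ⟪Dw bⱼ, bₖ⟫`. [folklore] -/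
theorem nsGeneratorPairing_eq_of_level
    (hb : ∀ i, Torus.IsSmooth (b i) ∧ Torus.IsDivFree (b i) ∧ Torus.HasZeroMean (b i) ∧
      ∀ k ∉ (Torus.freqBall N).erase (0 : Fin 3 → ℤ),
        UnitAddTorus.mFourierCoeff (EuclideanSpace.complexify ∘ (b i)) k = 0)
    (hbs : ∀ u : Torus.energySpace (Fin 3),
      (∀ k ∉ (Torus.freqBall N).erase (0 : Fin 3 → ℤ),
        UnitAddTorus.mFourierCoeff (EuclideanSpace.complexify ∘
          (u.1 : UnitAddTorus (Fin 3) → EuclideanSpace ℝ (Fin 3))) k = 0) →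
      ∀ x, Torus.fourierTruncate N (u.1 : UnitAddTorus (Fin 3) → EuclideanSpace ℝ (Fin 3)) x =
        ∑ i, Torus.pairing u.1 (b i) • b i x)
    (ν : ℝ) (f : UnitAddTorus (Fin 3) → EuclideanSpace ℝ (Fin 3))
    {w : UnitAddTorus (Fin 3) → EuclideanSpace ℝ (Fin 3)} (hw : Torus.IsSmooth w)
    (u : Torus.energySpace (Fin 3))
    (hu : ∀ k ∉ (Torus.freqBall N).erase (0 : Fin 3 → ℤ),
      UnitAddTorus.mFourierCoeff (EuclideanSpace.complexify ∘
        (u.1 : UnitAddTorus (Fin 3) → EuclideanSpace ℝ (Fin 3))) k = 0) :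
    Torus.nsGeneratorPairing ν f u w =
      (∫ y, ⟪f y, w y⟫_ℝ) +
        ν * (∑ j, Torus.pairing u.1 (b j) * (∫ y, ⟪b j y, Torus.laplacian w y⟫_ℝ)) +
        ∑ j, ∑ k, Torus.pairing u.1 (b j) * (Torus.pairing u.1 (b k) *
          (∫ y, ⟪Torus.fderiv w y (b j y), b k y⟫_ℝ)) := by
  have hae := coe_ae_eq_sum_of_level hbs u hu
  have hiL : ∀ j, Integrable (fun y => ⟪b j y, Torus.laplacian w y⟫_ℝ) volume := fun j =>
    Torus.integrable_inner_of_continuous (hb j).1.integrable hw.laplacian.continuous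
  have hiQ : ∀ j k, Integrable (fun y => ⟪Torus.fderiv w y (b j y), b k y⟫_ℝ) volume := fun j k =>
    ((continuous_fderiv_apply hw (hb j).1.continuous).inner (hb k).1.continuous).integrable_unitAddTorus
  unfold Torus.nsGeneratorPairing Torus.inertialPairing
  congr 2
  · congr 1
    calc ∫ y, ⟪(u.1 : UnitAddTorus (Fin 3) → EuclideanSpace ℝ (Fin 3)) y, Torus.laplacian w y⟫_ℝ
        = ∫ y, ⟪∑ j, Torus.pairing u.1 (b j) • b j y, Torus.laplacian w y⟫_ℝ := by
          refine integral_congr_ae ?_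
          filter_upwards [hae] with y hy
          rw [hy]
      _ = ∑ j, Torus.pairing u.1 (b j) * (∫ y, ⟪b j y, Torus.laplacian w y⟫_ℝ) := by
          simp_rw [sum_inner, real_inner_smul_left]
          rw [integral_finsetSum _ fun j _ => (hiL j).const_mul _]
          simp_rw [integral_const_mul]
  · calc ∫ y, ⟪Torus.fderiv w y ((u.1 : UnitAddTorus (Fin 3) → EuclideanSpace ℝ (Fin 3)) y),
          (u.1 : UnitAddTorus (Fin 3) → EuclideanSpace ℝ (Fin 3)) y⟫_ℝ
        = ∫ y, ⟪Torus.fderiv w y (∑ j, Torus.pairing u.1 (b j) • b j y),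
            ∑ k, Torus.pairing u.1 (b k) • b k y⟫_ℝ := by
          refine integral_congr_ae ?_
          filter_upwards [hae] with y hy
          rw [hy]
      _ = ∫ y, ∑ j, ∑ k, Torus.pairing u.1 (b j) * (Torus.pairing u.1 (b k) *
            ⟪Torus.fderiv w y (b j y), b k y⟫_ℝ) := by
          refine integral_congr_ae (ae_of_all _ fun y => ?_)
          simp_rw [map_sum, map_smul, sum_inner, real_inner_smul_left, inner_sum,
            real_inner_smul_right, Finset.mul_sum]
      _ = ∑ j, ∑ k, Torus.pairing u.1 (b j) * (Torus.pairing u.1 (b k) *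
            (∫ y, ⟪Torus.fderiv w y (b j y), b k y⟫_ℝ)) := by
          rw [integral_finsetSum _ fun j _ =>
            integrable_finsetSum _ fun k _ => ((hiQ j k).const_mul _).const_mul _]
          refine Finset.sum_congr rfl fun j _ => ?_
          rw [integral_finsetSum _ fun k _ => ((hiQ j k).const_mul _).const_mul _]
          refine Finset.sum_congr rfl fun k _ => ?_
          rw [integral_const_mul, integral_const_mul]

/-- **The generator against a fixed smooth field is a quadratic polynomial in the coordinates**:
`⟨F(u), w⟩ = R_w(x)` with
`R_w = C (f,w) + C ν · Σⱼ Xⱼ C (bⱼ, Δw) + Σⱼ Σₖ Xⱼ Xₖ C ∫⟪Dw bⱼ, bₖ⟫`. [folklore] -/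
theorem nsGeneratorPairing_eq_eval_of_level
    (hb : ∀ i, Torus.IsSmooth (b i) ∧ Torus.IsDivFree (b i) ∧ Torus.HasZeroMean (b i) ∧
      ∀ k ∉ (Torus.freqBall N).erase (0 : Fin 3 → ℤ),
        UnitAddTorus.mFourierCoeff (EuclideanSpace.complexify ∘ (b i)) k = 0)
    (hbs : ∀ u : Torus.energySpace (Fin 3),
      (∀ k ∉ (Torus.freqBall N).erase (0 : Fin 3 → ℤ),
        UnitAddTorus.mFourierCoeff (EuclideanSpace.complexify ∘
          (u.1 : UnitAddTorus (Fin 3) → EuclideanSpace ℝ (Fin 3))) k = 0) →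
      ∀ x, Torus.fourierTruncate N (u.1 : UnitAddTorus (Fin 3) → EuclideanSpace ℝ (Fin 3)) x =
        ∑ i, Torus.pairing u.1 (b i) • b i x)
    (ν : ℝ) (f : UnitAddTorus (Fin 3) → EuclideanSpace ℝ (Fin 3))
    {w : UnitAddTorus (Fin 3) → EuclideanSpace ℝ (Fin 3)} (hw : Torus.IsSmooth w)
    (u : Torus.energySpace (Fin 3))
    (hu : ∀ k ∉ (Torus.freqBall N).erase (0 : Fin 3 → ℤ),
      UnitAddTorus.mFourierCoeff (EuclideanSpace.complexify ∘
        (u.1 : UnitAddTorus (Fin 3) → EuclideanSpace ℝ (Fin 3))) k = 0) :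
    Torus.nsGeneratorPairing ν f u w =
      MvPolynomial.eval (fun i => Torus.pairing u.1 (b i))
        (C (∫ y, ⟪f y, w y⟫_ℝ) + C ν * ∑ j, X j * C (∫ y, ⟪b j y, Torus.laplacian w y⟫_ℝ) +
          ∑ j, ∑ k, X j * (X k * C (∫ y, ⟪Torus.fderiv w y (b j y), b k y⟫_ℝ))) := by
  rw [nsGeneratorPairing_eq_of_level hb hbs ν f hw u hu]
  simp only [map_add, map_mul, map_sum, eval_C, eval_X]

/-- The Euler pairing (`ν = 0`, `f = 0`) against a fixed smooth field is the quadratic part: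
`⟨B(u,u), w⟩ = Σⱼ Σₖ xⱼ xₖ ∫⟪Dw bⱼ, bₖ⟫`. [folklore] -/
theorem nsGeneratorPairing_zero_zero_eq_eval_of_level
    (hb : ∀ i, Torus.IsSmooth (b i) ∧ Torus.IsDivFree (b i) ∧ Torus.HasZeroMean (b i) ∧
      ∀ k ∉ (Torus.freqBall N).erase (0 : Fin 3 → ℤ),
        UnitAddTorus.mFourierCoeff (EuclideanSpace.complexify ∘ (b i)) k = 0)
    (hbs : ∀ u : Torus.energySpace (Fin 3),
      (∀ k ∉ (Torus.freqBall N).erase (0 : Fin 3 → ℤ),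
        UnitAddTorus.mFourierCoeff (EuclideanSpace.complexify ∘
          (u.1 : UnitAddTorus (Fin 3) → EuclideanSpace ℝ (Fin 3))) k = 0) →
      ∀ x, Torus.fourierTruncate N (u.1 : UnitAddTorus (Fin 3) → EuclideanSpace ℝ (Fin 3)) x =
        ∑ i, Torus.pairing u.1 (b i) • b i x)
    {w : UnitAddTorus (Fin 3) → EuclideanSpace ℝ (Fin 3)} (hw : Torus.IsSmooth w)
    (u : Torus.energySpace (Fin 3))
    (hu : ∀ k ∉ (Torus.freqBall N).erase (0 : Fin 3 → ℤ),
      UnitAddTorus.mFourierCoeff (EuclideanSpace.complexify ∘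
        (u.1 : UnitAddTorus (Fin 3) → EuclideanSpace ℝ (Fin 3))) k = 0) :
    Torus.nsGeneratorPairing (d := Fin 3) 0 0 u w =
      MvPolynomial.eval (fun i => Torus.pairing u.1 (b i))
        (∑ j, ∑ k, X j * (X k * C (∫ y, ⟪Torus.fderiv w y (b j y), b k y⟫_ℝ))) := by
  rw [nsGeneratorPairing_eq_of_level hb hbs 0 0 hw u hu]
  simp only [map_mul, map_sum, eval_C, eval_X, Pi.zero_apply, inner_zero_left,
    integral_zero, zero_mul, zero_add]

/-! ## The row of a polynomial test -/

/-- **The row is the evaluation of an explicit polynomial.** For band tests `gᵢ`, a polynomial `P`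
and a level-`N` field `u` with coordinates `x`:
`⟨F(u), ∇p(u)⟩ = Σᵢ (∂ᵢP)(ℓ(x)) · Rᵢ(x)`, where `ℓⱼ = Σₗ C (gⱼ, bₗ) Xₗ` are the coordinate forms of
the pairings `(u, gⱼ)` and `Rᵢ` is the quadratic polynomial of `⟨F(u), gᵢ⟩`. [folklore] -/
theorem row_eq_eval
    (hb : ∀ i, Torus.IsSmooth (b i) ∧ Torus.IsDivFree (b i) ∧ Torus.HasZeroMean (b i) ∧
      ∀ k ∉ (Torus.freqBall N).erase (0 : Fin 3 → ℤ),
        UnitAddTorus.mFourierCoeff (EuclideanSpace.complexify ∘ (b i)) k = 0)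
    (hbs : ∀ u : Torus.energySpace (Fin 3),
      (∀ k ∉ (Torus.freqBall N).erase (0 : Fin 3 → ℤ),
        UnitAddTorus.mFourierCoeff (EuclideanSpace.complexify ∘
          (u.1 : UnitAddTorus (Fin 3) → EuclideanSpace ℝ (Fin 3))) k = 0) →
      ∀ x, Torus.fourierTruncate N (u.1 : UnitAddTorus (Fin 3) → EuclideanSpace ℝ (Fin 3)) x =
        ∑ i, Torus.pairing u.1 (b i) • b i x)
    (ν : ℝ) {f : UnitAddTorus (Fin 3) → EuclideanSpace ℝ (Fin 3)} (hf : Torus.IsSmooth f)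
    {m : ℕ} {g : Fin m → UnitAddTorus (Fin 3) → EuclideanSpace ℝ (Fin 3)}
    (hg : ∀ i, Torus.IsSmooth (g i) ∧ Torus.IsDivFree (g i) ∧ Torus.HasZeroMean (g i) ∧
      ∀ k ∉ (Torus.freqBall N).erase (0 : Fin 3 → ℤ),
        UnitAddTorus.mFourierCoeff (EuclideanSpace.complexify ∘ (g i)) k = 0)
    (P : MvPolynomial (Fin m) ℝ) (u : Torus.energySpace (Fin 3))
    (hu : ∀ k ∉ (Torus.freqBall N).erase (0 : Fin 3 → ℤ),
      UnitAddTorus.mFourierCoeff (EuclideanSpace.complexify ∘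
        (u.1 : UnitAddTorus (Fin 3) → EuclideanSpace ℝ (Fin 3))) k = 0) :
    Torus.nsGeneratorPairing ν f u
        (fun x => ∑ i, (MvPolynomial.eval (fun j => Torus.pairing u.1 (g j))
          (MvPolynomial.pderiv i P)) • g i x) =
      MvPolynomial.eval (fun i => Torus.pairing u.1 (b i))
        (∑ i, bind₁ (fun j => ∑ l, C (∫ y, ⟪g j y, b l y⟫_ℝ) * X l) (pderiv i P) *
          (C (∫ y, ⟪f y, g i y⟫_ℝ) + C ν * ∑ j, X j * C (∫ y, ⟪b j y, Torus.laplacian (g i) y⟫_ℝ) +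
            ∑ j, ∑ k, X j * (X k * C (∫ y, ⟪Torus.fderiv (g i) y (b j y), b k y⟫_ℝ)))) := by
  have hfun : (fun j => Torus.pairing u.1 (g j)) = fun j =>
      MvPolynomial.eval (fun i => Torus.pairing u.1 (b i)) (∑ l, C (∫ y, ⟪g j y, b l y⟫_ℝ) * X l) := by
    funext j
    rw [pairing_band_eq_sum hb hbs (hg j) u]
    simp only [map_sum, map_mul, eval_C, eval_X]
  rw [Torus.nsGeneratorPairing_sum_smul ν hf.integrable u Finset.univ _ fun i _ => (hg i).1,
    map_sum]
  refine Finset.sum_congr rfl fun i _ => ?_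
  rw [map_mul, eval_bind₁, ← hfun, nsGeneratorPairing_eq_eval_of_level hb hbs ν f (hg i).1 u hu]

/-- The Euler-pairing version of `row_eq_eval` (`ν = 0`, `f = 0`): only the quadratic parts `Rᵢ⁽²⁾`
survive. [folklore] -/
theorem euler_row_eq_eval
    (hb : ∀ i, Torus.IsSmooth (b i) ∧ Torus.IsDivFree (b i) ∧ Torus.HasZeroMean (b i) ∧
      ∀ k ∉ (Torus.freqBall N).erase (0 : Fin 3 → ℤ),
        UnitAddTorus.mFourierCoeff (EuclideanSpace.complexify ∘ (b i)) k = 0)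
    (hbs : ∀ u : Torus.energySpace (Fin 3),
      (∀ k ∉ (Torus.freqBall N).erase (0 : Fin 3 → ℤ),
        UnitAddTorus.mFourierCoeff (EuclideanSpace.complexify ∘
          (u.1 : UnitAddTorus (Fin 3) → EuclideanSpace ℝ (Fin 3))) k = 0) →
      ∀ x, Torus.fourierTruncate N (u.1 : UnitAddTorus (Fin 3) → EuclideanSpace ℝ (Fin 3)) x =
        ∑ i, Torus.pairing u.1 (b i) • b i x)
    {m : ℕ} {g : Fin m → UnitAddTorus (Fin 3) → EuclideanSpace ℝ (Fin 3)}
    (hg : ∀ i, Torus.IsSmooth (g i) ∧ Torus.IsDivFree (g i) ∧ Torus.HasZeroMean (g i) ∧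
      ∀ k ∉ (Torus.freqBall N).erase (0 : Fin 3 → ℤ),
        UnitAddTorus.mFourierCoeff (EuclideanSpace.complexify ∘ (g i)) k = 0)
    (P : MvPolynomial (Fin m) ℝ) (u : Torus.energySpace (Fin 3))
    (hu : ∀ k ∉ (Torus.freqBall N).erase (0 : Fin 3 → ℤ),
      UnitAddTorus.mFourierCoeff (EuclideanSpace.complexify ∘
        (u.1 : UnitAddTorus (Fin 3) → EuclideanSpace ℝ (Fin 3))) k = 0) :
    Torus.nsGeneratorPairing (d := Fin 3) 0 0 u
        (fun x => ∑ i, (MvPolynomial.eval (fun j => Torus.pairing u.1 (g j))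
          (MvPolynomial.pderiv i P)) • g i x) =
      MvPolynomial.eval (fun i => Torus.pairing u.1 (b i))
        (∑ i, bind₁ (fun j => ∑ l, C (∫ y, ⟪g j y, b l y⟫_ℝ) * X l) (pderiv i P) *
          ∑ j, ∑ k, X j * (X k * C (∫ y, ⟪Torus.fderiv (g i) y (b j y), b k y⟫_ℝ))) := by
  have hfun : (fun j => Torus.pairing u.1 (g j)) = fun j =>
      MvPolynomial.eval (fun i => Torus.pairing u.1 (b i)) (∑ l, C (∫ y, ⟪g j y, b l y⟫_ℝ) * X l) := by
    funext j
    rw [pairing_band_eq_sum hb hbs (hg j) u]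
    simp only [map_sum, map_mul, eval_C, eval_X]
  have h0 : Integrable (0 : UnitAddTorus (Fin 3) → EuclideanSpace ℝ (Fin 3)) volume :=
    integrable_zero _ _ _
  rw [Torus.nsGeneratorPairing_sum_smul 0 h0 u Finset.univ _ fun i _ => (hg i).1, map_sum]
  refine Finset.sum_congr rfl fun i _ => ?_
  rw [map_mul, eval_bind₁, ← hfun, nsGeneratorPairing_zero_zero_eq_eval_of_level hb hbs (hg i).1 u hu]

/-! ## I4 — existence of the row polynomial -/

/-- **I4 — ROW POLYNOMIAL.** For an orthonormal band basis `b` of `V_N`, a smooth force `f`, band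
tests `gᵢ` and a polynomial `P` of total degree `≤ d`, there is a polynomial `Q` in the coordinates,
of total degree `≤ d + 1`, such that on every level-`N` field the row `⟨F(u), ∇p(u)⟩` equals `Q(x)`,
and whose homogeneous component of degree `d + 1` evaluates to the Euler pairing
`⟨B(u,u), ∇p_d(u)⟩` of the top component `p_d = P_d((u,g))` of the test. [folklore] -/
theorem exists_rowPoly :
    ∀ {N n : ℕ} {b : Fin n → UnitAddTorus (Fin 3) → EuclideanSpace ℝ (Fin 3)},
      (∀ i, Torus.IsSmooth (b i) ∧ Torus.IsDivFree (b i) ∧ Torus.HasZeroMean (b i) ∧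
        ∀ k ∉ (Torus.freqBall N).erase (0 : Fin 3 → ℤ),
          UnitAddTorus.mFourierCoeff (EuclideanSpace.complexify ∘ (b i)) k = 0) →
      (∀ i j, ∫ x, ⟪b i x, b j x⟫_ℝ = if i = j then (1 : ℝ) else 0) →
      (∀ u : Torus.energySpace (Fin 3),
        (∀ k ∉ (Torus.freqBall N).erase (0 : Fin 3 → ℤ),
          UnitAddTorus.mFourierCoeff (EuclideanSpace.complexify ∘
            (u.1 : UnitAddTorus (Fin 3) → EuclideanSpace ℝ (Fin 3))) k = 0) →
        ∀ x, Torus.fourierTruncate N (u.1 : UnitAddTorus (Fin 3) → EuclideanSpace ℝ (Fin 3)) x =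
          ∑ i, Torus.pairing u.1 (b i) • b i x) →
      ∀ (ν : ℝ) (f : UnitAddTorus (Fin 3) → EuclideanSpace ℝ (Fin 3)), Torus.IsSmooth f →
      ∀ (m : ℕ) (g : Fin m → UnitAddTorus (Fin 3) → EuclideanSpace ℝ (Fin 3)),
      (∀ i, Torus.IsSmooth (g i) ∧ Torus.IsDivFree (g i) ∧ Torus.HasZeroMean (g i) ∧
        ∀ k ∉ (Torus.freqBall N).erase (0 : Fin 3 → ℤ),
          UnitAddTorus.mFourierCoeff (EuclideanSpace.complexify ∘ (g i)) k = 0) →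
      ∀ (P : MvPolynomial (Fin m) ℝ) (d : ℕ), P.totalDegree ≤ d →
      ∃ Q : MvPolynomial (Fin n) ℝ, Q.totalDegree ≤ d + 1 ∧
        (∀ u : Torus.energySpace (Fin 3), (∀ k ∉ (Torus.freqBall N).erase (0 : Fin 3 → ℤ),
            UnitAddTorus.mFourierCoeff (EuclideanSpace.complexify ∘
              (u.1 : UnitAddTorus (Fin 3) → EuclideanSpace ℝ (Fin 3))) k = 0) →
          Torus.nsGeneratorPairing ν f u
              (fun x => ∑ i, (MvPolynomial.eval (fun j => Torus.pairing u.1 (g j))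
                (MvPolynomial.pderiv i P)) • g i x) =
            MvPolynomial.eval (fun i => Torus.pairing u.1 (b i)) Q) ∧
        (∀ u : Torus.energySpace (Fin 3), (∀ k ∉ (Torus.freqBall N).erase (0 : Fin 3 → ℤ),
            UnitAddTorus.mFourierCoeff (EuclideanSpace.complexify ∘
              (u.1 : UnitAddTorus (Fin 3) → EuclideanSpace ℝ (Fin 3))) k = 0) →
          MvPolynomial.eval (fun i => Torus.pairing u.1 (b i))
              (MvPolynomial.homogeneousComponent (d + 1) Q) =
            Torus.nsGeneratorPairing (d := Fin 3) 0 0 u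
              (fun x => ∑ i, (MvPolynomial.eval (fun j => Torus.pairing u.1 (g j))
                (MvPolynomial.pderiv i (MvPolynomial.homogeneousComponent d P))) • g i x)) := by
  intro N n b hb _hbo hbs ν f hf m g hg P d hP
  -- the coordinate forms `ℓ`, the quadratic polynomials `R i`, their top parts `R2 i`
  set ℓ : Fin m → MvPolynomial (Fin n) ℝ := fun j => ∑ l, C (∫ y, ⟪g j y, b l y⟫_ℝ) * X l with hℓ
  set R : Fin m → MvPolynomial (Fin n) ℝ := fun i =>
    C (∫ y, ⟪f y, g i y⟫_ℝ) + C ν * ∑ j, X j * C (∫ y, ⟪b j y, Torus.laplacian (g i) y⟫_ℝ) +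
      ∑ j, ∑ k, X j * (X k * C (∫ y, ⟪Torus.fderiv (g i) y (b j y), b k y⟫_ℝ)) with hR
  set R2 : Fin m → MvPolynomial (Fin n) ℝ := fun i =>
    ∑ j, ∑ k, X j * (X k * C (∫ y, ⟪Torus.fderiv (g i) y (b j y), b k y⟫_ℝ)) with hR2
  have hℓh : ∀ j, (ℓ j).IsHomogeneous 1 := fun j => isHomogeneous_sum_C_mul_X _ _ _
  have hR2h : ∀ i, (R2 i).IsHomogeneous 2 := fun i => isHomogeneous_sum_X_mul_X_mul_C _ _
  have hRdeg : ∀ i, (R i).totalDegree ≤ 2 := fun i => by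
    refine (totalDegree_add _ _).trans (max_le ((totalDegree_affine_le _ _ _ _ _).trans one_le_two) ?_)
    exact (hR2h i).totalDegree_le
  have hRsub : ∀ i, (R i - R2 i).totalDegree ≤ 1 := fun i => by
    have : R i - R2 i = C (∫ y, ⟪f y, g i y⟫_ℝ) +
        C ν * ∑ j, X j * C (∫ y, ⟪b j y, Torus.laplacian (g i) y⟫_ℝ) := by
      simp only [hR, hR2]; ring
    rw [this]
    exact totalDegree_affine_le _ _ _ _ _
  -- the row polynomial and its top part
  set Q : MvPolynomial (Fin n) ℝ := ∑ i, bind₁ ℓ (pderiv i P) * R i with hQ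
  set Qtop : MvPolynomial (Fin n) ℝ :=
    ∑ i, bind₁ ℓ (pderiv i (homogeneousComponent d P)) * R2 i with hQtop
  have hQdeg : Q.totalDegree ≤ d + 1 :=
    totalDegree_finsetSum_le fun i _ => totalDegree_bind₁_pderiv_mul_le hℓh i (by
      have := hRdeg i; omega)
  -- `Qtop` is homogeneous of degree `d + 1`
  have hQtoph : Qtop.IsHomogeneous (d + 1) := by
    rcases Nat.eq_zero_or_pos d with hd | hd
    · subst hd
      have h0 : Qtop = 0 := by
        simp only [hQtop, homogeneousComponent_zero, pderiv_C, map_zero, zero_mul,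
          Finset.sum_const_zero]
      rw [h0]
      exact isHomogeneous_zero _ _ _
    · refine IsHomogeneous.sum _ _ _ fun i _ => ?_
      have h1 := isHomogeneous_bind₁ hℓh ((homogeneousComponent_isHomogeneous d P).pderiv (i := i))
      have h2 := h1.mul (hR2h i)
      have hd' : d - 1 + 2 = d + 1 := by omega
      rwa [hd'] at h2
  -- `Q - Qtop` has degree `≤ d`
  have hlow : (Q - Qtop).totalDegree ≤ d := by
    have hsplit : Q - Qtop = ∑ i, (bind₁ ℓ (pderiv i (P - homogeneousComponent d P)) * R i +
        bind₁ ℓ (pderiv i (homogeneousComponent d P)) * (R i - R2 i)) := by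
      simp only [hQ, hQtop, map_sub, ← Finset.sum_sub_distrib]
      refine Finset.sum_congr rfl fun i _ => ?_
      ring
    rw [hsplit]
    refine totalDegree_finsetSum_le fun i _ => (totalDegree_add _ _).trans (max_le ?_ ?_)
    · rcases Nat.eq_zero_or_pos d with hd | hd
      · subst hd
        have hP0 : P - homogeneousComponent 0 P = 0 := by
          rw [homogeneousComponent_zero, ← (totalDegree_eq_zero_iff_eq_C).1 (Nat.le_zero.1 hP),
            sub_self]
        rw [hP0, map_zero, map_zero, zero_mul, totalDegree_zero]
      · exact totalDegree_bind₁_pderiv_mul_le hℓh i (by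
          have h1 := totalDegree_sub_homogeneousComponent_le hP
          have h2 := hRdeg i
          omega)
    · exact totalDegree_bind₁_pderiv_mul_le hℓh i (by
        have h1 : (homogeneousComponent d P).totalDegree ≤ d :=
          (homogeneousComponent_isHomogeneous d P).totalDegree_le
        have h2 := hRsub i
        omega)
  have htop : homogeneousComponent (d + 1) Q = Qtop :=
    homogeneousComponent_eq_of_add hQtoph (Nat.lt_succ_of_le hlow)
  refine ⟨Q, hQdeg, fun u hu => row_eq_eval hb hbs ν hf hg P u hu, fun u hu => ?_⟩
  rw [htop, hQtop, euler_row_eq_eval hb hbs hg (homogeneousComponent d P) u hu]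

end Summit.AnomalousDissipation.AnomalousDissipation.Theorems.MomentParityQuarticGate
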